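import Mathlib.Data.Fintype.BigOperators
import Mathlib.Data.Fintype.Fin
import Mathlib.Algebra.BigOperators.Fin
import Mathlib.Algebra.Order.BigOperators.Ring.Finset
import Mathlib.Data.Real.Basic
import Mathlib.Data.Int.Interval
import Mathlib.Algebra.BigOperators.Field
import Mathlib.Tactic.FieldSimp
import Mathlib.Tactic.Ring
import Mathlib.Tactic.Linarith
import Mathlib.Tactic.Positivity
import HarnessLib

/-!
# A coin-driven pseudo-Gaussian sampler: definition and exact law

Topic `Probability/Distributions`. A sampler for (an approximation of) the centred normal law of
variance `1/2` on the grid `hℤ`, `h = 2^{-b}`, that uses NOTHING BUT fair coins, integer arithmetic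
and comparisons — so that a polynomial-time Turing machine runs it and its law is an exact finite
count. Written for the finite-precision hiding step in the discharge of Aaronson–Arkhipov's Main
Theorem (Theory of Computing 9 (2013), Thm. 1.3; named fact
`Literature.Computability.QuantumComplexity.gpeSolvableInFBPPRel_NPRel_of_approxBosonSamplingOracle`),
where the `m - n` decoy rows hiding a Gaussian matrix must be manufactured from the reduction's
coins. Everything here is proved; the analytic comparison with the Gaussian is in the sequel
`PseudoGaussianSamplerEstimates.lean`.

## The algorithm (`PGParams`: `b r k J`; `T = 2^{r+b}`, `Mmax = 2^{2r+k}`, `M(a) = ⌊a² 2^k/4^b⌋`)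

One ATTEMPT reads a value `v ∈ [0, 2T)` and `Mmax` blocks of `k` coins (`AttemptCoins`): `v = 0` is
rejected; otherwise `j = v - T ∈ (-T, T)` is proposed and ACCEPTED iff the first `M(|j|)` blocks are
all nonzero (`attempt`). Since a block of `k` fair coins is nonzero with probability `1 - 2^{-k}`,
`Pr[attempt = j] = φ(j)/(2T)` with `φ(j) = (1 - 2^{-k})^{M(|j|)} ≈ e^{-(jh)²}` (`phi`,
`cntSome_attempt`, `cntSome_div`): von Neumann's idea of realising `e^{-x}` by coin events, with no
evaluation of `exp`. The SAMPLER returns the first accepted value among `J` independent attempts,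
`0` if none (`sampler`, `firstSuccess`).

## Results

* `cntFirst_succ`, `cntFirst_mul_eq` — the first-success recursion and its closed form, for any
  attempt function on a finite coin type (`cntSome`, `cntNone`, `cntFirst`).
* `cntSome_attempt`, `cntNone_add_sum_cntSome`, `card_accSet` — the fibres of the attempt.
* **`law_eq`** — the exact law: `ℓ'(j) = (φ(j)/A)(1 - p₀^J) + [j = 0] p₀^J`, where
  `A = ∑_{|j|<T} φ(j) = 1 + 2 ∑_{a=1}^{T-1} (1 - 2^{-k})^{M(a)}` (`A`, `A_eq_one_add`,
  `1 ≤ A < 2T`) and `p₀ = 1 - A/(2T) ∈ [0, 1)` is the failure probability of one attempt (`pNone`).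
* `law_neg` (the law is EVEN, hence exactly mean zero), `law_eq_zero` (support in `(-T, T)`),
  `law_nonneg`, `phi_div_mul_le_law` (`ℓ'(j) ≥ (1 - p₀^J) φ(j)/A`).

## Design

* Coins are structured (`Fin (2T) × (Fin Mmax → Fin (2^k))`, and `Fin J →` that) rather than a
  flat bit string: the machine-level bridge (reading the same fields off a coin string by position,
  least significant bit first) is a bijection and preserves the uniform law; it lives with the
  machine.
* Exact evenness of the law is what the permanent second-moment argument downstream needs (mean
  zero, not approximately zero); it is why `v = 0` is rejected rather than mapped to `j = -T`.

## References

* J. von Neumann, *Various techniques used in connection with random digits*, NBS Appl. Math.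
  Ser. 12 (1951) 36–38 (rejection with coin-realised acceptance probabilities).
* C. F. F. Karney, *Sampling exactly from the normal distribution*, ACM Trans. Math. Software 42
  (2016), Art. 3, §2 (Bernoulli trials with probability `e^{-x}` from uniform digits only). (The
  finite-precision variant here, with acceptance `(1 - 2^{-k})^{⌊x/q⌋}`, is analysed from scratch.)
-/

namespace Literature.Probability.Distributions

open Finset

/-! ### Generic: the law of the first success among `J` independent attempts -/

section FirstSome

/-- The value of the first successful attempt in a list of attempt outcomes (default `0`).
[folklore] -/
def firstSome : List (Option ℤ) → ℤ
  | [] => 0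
  | some j :: _ => j
  | none :: l => firstSome l

variable {C : Type*} [Fintype C] (att : C → Option ℤ)

/-- Running `J` independent attempts: the value of the first success. [folklore] -/
def firstSuccess (J : ℕ) (c : Fin J → C) : ℤ := firstSome (List.ofFn fun i => att (c i))

/-- The number of attempt-coin values on which the attempt returns `some j`. [folklore] -/
def cntSome (j : ℤ) : ℕ := (univ.filter fun c => att c = some j).card

/-- The number of attempt-coin values on which the attempt fails. [folklore] -/
def cntNone : ℕ := (univ.filter fun c => att c = none).card

/-- The number of `J`-tuples of attempt coins on which the first success has value `j`.
[folklore] -/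
def cntFirst (J : ℕ) (j : ℤ) : ℕ := (univ.filter fun c : Fin J → C => firstSuccess att J c = j).card

/-- With no attempt the default value `0` is returned. [folklore] -/
theorem cntFirst_zero (j : ℤ) : cntFirst att 0 j = if j = 0 then 1 else 0 := by
  unfold cntFirst firstSuccess
  simp only [List.ofFn_zero, firstSome]
  by_cases hj : j = 0
  · subst hj; simp
  · rw [if_neg hj]
    simp [Ne.symm hj]

/-- **Recurrence of the first-success counts**: split off the first attempt —
`cntFirst (J+1) j = cntSome j · |C|^J + cntNone · cntFirst J j`. [folklore] -/
theorem cntFirst_succ (J : ℕ) (j : ℤ) :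
    cntFirst att (J + 1) j = cntSome att j * Fintype.card C ^ J + cntNone att * cntFirst att J j := by
  classical
  unfold cntFirst
  -- count over pairs (first attempt, remaining attempts)
  rw [← Finset.card_map (Fin.consEquiv fun _ => C).symm.toEmbedding]
  have hmap : (univ.filter fun c : Fin (J + 1) → C => firstSuccess att (J + 1) c = j).map
      (Fin.consEquiv fun _ => C).symm.toEmbedding =
      univ.filter fun p : C × (Fin J → C) => firstSuccess att (J + 1) (Fin.cons p.1 p.2) = j := by
    ext ⟨a, f⟩
    simp only [mem_map, mem_filter, mem_univ, true_and, Equiv.coe_toEmbedding]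
    constructor
    · rintro ⟨c, hc, hcaf⟩
      have : c = Fin.cons a f := by
        rw [← (Fin.consEquiv fun _ => C).apply_symm_apply c, hcaf]
        rfl
      rwa [this] at hc
    · intro h
      exact ⟨Fin.cons a f, h, by simp⟩
  rw [hmap]
  -- the first-success value after splitting
  have hval : ∀ (a : C) (f : Fin J → C), firstSuccess att (J + 1) (Fin.cons a f) =
      match att a with
      | some j' => j'
      | none => firstSuccess att J f := by
    intro a f
    unfold firstSuccess
    rw [List.ofFn_succ]
    simp only [Fin.cons_zero, Fin.cons_succ]
    cases att a <;> rfl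
  -- sum over the first coordinate
  rw [Finset.card_filter, Fintype.sum_prod_type]
  simp_rw [hval]
  have hsplit : ∀ a : C, (∑ f : Fin J → C, if (match att a with
      | some j' => j'
      | none => firstSuccess att J f) = j then 1 else 0) =
      (if att a = some j then Fintype.card C ^ J else 0) +
        (if att a = none then cntFirst att J j else 0) := by
    intro a
    cases ha : att a with
    | none =>
      simp only [reduceCtorEq, if_false, if_true, zero_add]
      rw [cntFirst, Finset.card_filter]
    | some j' =>
      simp only [Option.some.injEq, reduceCtorEq, if_false, add_zero]
      by_cases hj : j' = j
      · subst hj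
        simp
      · simp [hj]
  simp_rw [hsplit]
  rw [Finset.sum_add_distrib, ← Finset.sum_filter, ← Finset.sum_filter, Finset.sum_const,
    Finset.sum_const, smul_eq_mul, smul_eq_mul]
  rfl

/-- The counts partition the attempt coins: `∑ⱼ cntSome j + cntNone = |C|`, in the form needed:
`cntNone ≤ |C|`. [folklore] -/
theorem cntNone_le : cntNone att ≤ Fintype.card C :=
  (card_filter_le _ _).trans (by rw [card_univ])

/-- **Closed form of the first-success law** (as counts, multiplied out): with `p₁ = cntSome j`,
`p₀ = cntNone`, `K = |C|`,
`cntFirst J j · (K - p₀) = p₁ (K^J - p₀^J) + [j = 0] p₀^J (K - p₀)`. [folklore] -/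
theorem cntFirst_mul_eq (J : ℕ) (j : ℤ) :
    (cntFirst att J j : ℤ) * (Fintype.card C - cntNone att) =
      cntSome att j * ((Fintype.card C : ℤ) ^ J - (cntNone att : ℤ) ^ J) +
        (if j = 0 then (cntNone att : ℤ) ^ J * (Fintype.card C - cntNone att) else 0) := by
  induction J with
  | zero =>
    rw [cntFirst_zero]
    split_ifs <;> simp
  | succ J ih =>
    rw [cntFirst_succ]
    push_cast
    have : ((cntSome att j : ℤ) * (Fintype.card C : ℤ) ^ J + cntNone att * cntFirst att J j) *
        (Fintype.card C - cntNone att) =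
        (cntSome att j : ℤ) * (Fintype.card C : ℤ) ^ J * (Fintype.card C - cntNone att) +
          cntNone att * ((cntFirst att J j : ℤ) * (Fintype.card C - cntNone att)) := by ring
    rw [this, ih]
    split_ifs <;> ring

end FirstSome

/-! ### The pseudo-Gaussian attempt -/

/-- Parameters of the sampler: mesh `h = 2^{-b}`, range `R = 2^r` (so `T = 2^{r+b}` grid points on
each side of `0`), acceptance granularity `q = 2^{-k}`, and `J` attempts. [folklore] -/
structure PGParams where
  /-- mesh exponent: `h = 2^{-b}` -/
  b : ℕ
  /-- range exponent: `R = T h = 2^r` -/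
  r : ℕ
  /-- acceptance granularity: `q = 2^{-k}` -/
  k : ℕ
  /-- number of attempts -/
  J : ℕ

namespace PGParams

variable (P : PGParams)

/-- `T = 2^{r+b}`: magnitudes range over `(-T, T)`. [folklore] -/
def T : ℕ := 2 ^ (P.r + P.b)

/-- The number of acceptance blocks read by one attempt: `R² 2^k = 2^{2r+k}`. [folklore] -/
def Mmax : ℕ := 2 ^ (2 * P.r + P.k)

/-- The number of acceptance blocks that must be nonzero for magnitude `a`:
`M(a) = ⌊a² 2^k / 4^b⌋ = ⌊(a h)²/q⌋`. [folklore] -/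
def M (a : ℕ) : ℕ := a ^ 2 * 2 ^ P.k / 4 ^ P.b

/-- For magnitudes in range, `M(a) < Mmax`. [folklore] -/
theorem M_lt_Mmax {a : ℕ} (ha : a < P.T) : P.M a < P.Mmax := by
  unfold M Mmax T at *
  have h4 : (4 : ℕ) ^ P.b = 2 ^ P.b * 2 ^ P.b := by
    rw [← mul_pow]; norm_num
  rw [h4, Nat.div_lt_iff_lt_mul (by positivity)]
  have ha2 : a ^ 2 < (2 ^ (P.r + P.b)) ^ 2 := Nat.pow_lt_pow_left ha two_ne_zero
  calc a ^ 2 * 2 ^ P.k < (2 ^ (P.r + P.b)) ^ 2 * 2 ^ P.k :=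
        Nat.mul_lt_mul_of_pos_right ha2 (by positivity)
    _ = 2 ^ (2 * P.r + P.k) * (2 ^ P.b * 2 ^ P.b) := by
        rw [← pow_mul, ← pow_add, ← pow_add, ← pow_add]; ring_nf

/-- The coins of one attempt: a magnitude value `v ∈ [0, 2T)` and `Mmax` acceptance blocks of `k`
bits each, read as numbers in `[0, 2^k)`. [folklore] -/
abbrev AttemptCoins : Type := Fin (2 * P.T) × (Fin P.Mmax → Fin (2 ^ P.k))

/-- **One attempt.** The magnitude value `v = 0` is rejected (this keeps the law symmetric);
otherwise `j = v - T ∈ (-T, T)` is proposed and accepted iff the first `M(|j|)` acceptance blocks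
are all nonzero — an event of probability exactly `(1 - 2^{-k})^{M(|j|)} ≈ e^{-(jh)²}`. [folklore] -/
def attempt (c : P.AttemptCoins) : Option ℤ :=
  if (c.1 : ℕ) = 0 then none
  else if ∀ i : Fin P.Mmax, (i : ℕ) < P.M (((c.1 : ℕ) : ℤ) - P.T).natAbs → c.2 i ≠ 0
    then some (((c.1 : ℕ) : ℤ) - P.T) else none

/-- **The sampler**: the first accepted value among `J` attempts (default `0`). [folklore] -/
def sampler (c : Fin P.J → P.AttemptCoins) : ℤ := firstSuccess P.attempt P.J c

/-- The unnormalised weight `φ(j) = (1 - 2^{-k})^{M(|j|)}` for `|j| < T`, `0` otherwise. [folklore] -/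
noncomputable def phi (j : ℤ) : ℝ :=
  if j.natAbs < P.T then (1 - (2 : ℝ)⁻¹ ^ P.k) ^ P.M j.natAbs else 0

/-- `φ` is even. [folklore] -/
theorem phi_neg (j : ℤ) : P.phi (-j) = P.phi j := by
  simp [phi, Int.natAbs_neg]

/-- `φ` vanishes outside `(-T, T)`. [folklore] -/
theorem phi_eq_zero {j : ℤ} (hj : P.T ≤ j.natAbs) : P.phi j = 0 := by
  rw [phi, if_neg (not_lt.2 hj)]

/-- `0 ≤ φ ≤ 1`. [folklore] -/
theorem phi_nonneg (j : ℤ) : 0 ≤ P.phi j := by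
  unfold phi
  split_ifs
  · apply pow_nonneg
    have : (2 : ℝ)⁻¹ ^ P.k ≤ 1 := pow_le_one₀ (by norm_num) (by norm_num)
    linarith
  · exact le_rfl

/-- `φ ≤ 1`. [folklore] -/
theorem phi_le_one (j : ℤ) : P.phi j ≤ 1 := by
  unfold phi
  split_ifs
  · apply pow_le_one₀
    · have : (2 : ℝ)⁻¹ ^ P.k ≤ 1 := pow_le_one₀ (by norm_num) (by norm_num)
      linarith
    · have : 0 ≤ (2 : ℝ)⁻¹ ^ P.k := by positivity
      linarith
  · exact zero_le_one

/-- `φ(0) = 1` (`M(0) = 0`). [folklore] -/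
theorem phi_zero : P.phi 0 = 1 := by
  have hT : 0 < P.T := by unfold T; positivity
  simp [phi, M, hT]

/-! ### Counting the outcomes of one attempt -/

/-- `T > 0`. [folklore] -/
theorem T_pos : 0 < P.T := by unfold T; positivity

/-- An accepted value lies in `(-T, T)`. [folklore] -/
theorem natAbs_lt_of_attempt_eq_some {c : P.AttemptCoins} {j : ℤ} (h : P.attempt c = some j) :
    j.natAbs < P.T := by
  unfold attempt at h
  split_ifs at h with h0 hacc
  simp only [Option.some.injEq] at h
  have h1 : (c.1 : ℕ) < 2 * P.T := c.1.isLt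
  omega

/-- The set of acceptance-block values passing the test for magnitude class `M`. [folklore] -/
def accSet (Mj : ℕ) : Finset (Fin P.Mmax → Fin (2 ^ P.k)) :=
  Fintype.piFinset fun i : Fin P.Mmax => if (i : ℕ) < Mj then univ.erase 0 else univ

/-- Membership in `accSet`. [folklore] -/
theorem mem_accSet {Mj : ℕ} {acc : Fin P.Mmax → Fin (2 ^ P.k)} :
    acc ∈ P.accSet Mj ↔ ∀ i : Fin P.Mmax, (i : ℕ) < Mj → acc i ≠ 0 := by
  rw [accSet, Fintype.mem_piFinset]
  refine forall_congr' fun i => ?_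
  split_ifs with hi
  · simp [hi]
  · simp [hi]

/-- `#accSet(M) = (2^k - 1)^M · (2^k)^{Mmax - M}` for `M ≤ Mmax`. [folklore] -/
theorem card_accSet {Mj : ℕ} (hM : Mj ≤ P.Mmax) :
    (P.accSet Mj).card = (2 ^ P.k - 1) ^ Mj * (2 ^ P.k) ^ (P.Mmax - Mj) := by
  rw [accSet, Fintype.card_piFinset]
  simp_rw [apply_ite Finset.card, card_erase_of_mem (mem_univ _), card_univ, Fintype.card_fin]
  rw [Finset.prod_ite, Finset.prod_const, Finset.prod_const]
  congr 1
  · rw [Fin.card_filter_val_lt, min_eq_right hM]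
  · congr 1
    have : (univ.filter fun i : Fin P.Mmax => ¬ (i : ℕ) < Mj) =
        (univ.filter fun i : Fin P.Mmax => (i : ℕ) < Mj)ᶜ := by
      ext i; simp
    rw [this, card_compl, Fin.card_filter_val_lt, Fintype.card_fin, min_eq_right hM]

/-- **The fibre of an accepted value**: for `|j| < T` the attempt returns `some j` exactly on the
coins with magnitude value `j + T` and acceptance blocks in `accSet (M |j|)`; for `|j| ≥ T` never.
Hence `#{attempt = some j} = [|j| < T] (2^k - 1)^{M|j|} (2^k)^{Mmax - M|j|}`. [folklore] -/
theorem cntSome_attempt (j : ℤ) :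
    cntSome P.attempt j =
      if j.natAbs < P.T then (2 ^ P.k - 1) ^ P.M j.natAbs * (2 ^ P.k) ^ (P.Mmax - P.M j.natAbs)
      else 0 := by
  classical
  unfold cntSome
  split_ifs with hj
  · -- the magnitude value
    have hv : (j + P.T).toNat < 2 * P.T := by omega
    set v : Fin (2 * P.T) := ⟨(j + P.T).toNat, hv⟩ with hvdef
    have hfilter : (univ.filter fun c : P.AttemptCoins => P.attempt c = some j) =
        ({v} : Finset (Fin (2 * P.T))) ×ˢ P.accSet (P.M j.natAbs) := by
      ext ⟨c1, c2⟩
      simp only [mem_filter, mem_univ, true_and, mem_product, mem_singleton, mem_accSet]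
      unfold attempt
      constructor
      · intro h
        split_ifs at h with h0 hacc
        simp only [Option.some.injEq] at h
        refine ⟨?_, ?_⟩
        · apply Fin.ext
          change (c1 : ℕ) = (j + P.T).toNat
          omega
        · rw [h] at hacc
          exact hacc
      · rintro ⟨hc1, hacc⟩
        have hc1' : (c1 : ℕ) = (j + P.T).toNat := by rw [hc1]
        have h0 : ¬ (c1 : ℕ) = 0 := by omega
        have hj' : ((c1 : ℕ) : ℤ) - P.T = j := by omega
        simp only [h0, if_false, hj']
        rw [if_pos hacc]
    rw [hfilter, card_product, card_singleton, one_mul, card_accSet P (P.M_lt_Mmax hj).le]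
  · rw [Finset.card_eq_zero, Finset.filter_eq_empty_iff]
    intro c _ h
    exact hj (P.natAbs_lt_of_attempt_eq_some h)

/-- The number of attempt coins: `2T · (2^k)^{Mmax}`. [folklore] -/
theorem card_attemptCoins : Fintype.card P.AttemptCoins = 2 * P.T * (2 ^ P.k) ^ P.Mmax := by
  simp [AttemptCoins, Fintype.card_prod, Fintype.card_fin]

/-- **Failures and successes partition the attempt coins**:
`cntNone + ∑_{j ∈ (-T, T)} cntSome j = 2T (2^k)^{Mmax}`. [folklore] -/
theorem cntNone_add_sum_cntSome :
    cntNone P.attempt + ∑ j ∈ Finset.Ioo (-(P.T : ℤ)) P.T, cntSome P.attempt j =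
      Fintype.card P.AttemptCoins := by
  classical
  set I : Finset (Option ℤ) := insert none ((Finset.Ioo (-(P.T : ℤ)) P.T).image some) with hI
  have hmem : ∀ c ∈ (univ : Finset P.AttemptCoins), P.attempt c ∈ I := by
    intro c _
    rw [hI, mem_insert, mem_image]
    cases h : P.attempt c with
    | none => left; rfl
    | some j =>
      right
      refine ⟨j, ?_, rfl⟩
      have := P.natAbs_lt_of_attempt_eq_some h
      rw [Finset.mem_Ioo]; omega
  have hcard := Finset.card_eq_sum_card_fiberwise hmem
  rw [card_univ] at hcard
  rw [hcard, hI, Finset.sum_insert, Finset.sum_image]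
  · rfl
  · intro x _ y _ hxy; exact Option.some_injective _ hxy
  · simp

/-! ### The law of the sampler -/

/-- The normalising sum `A = ∑_{j ∈ (-T, T)} φ(j)`. [folklore] -/
noncomputable def A : ℝ := ∑ j ∈ Finset.Ioo (-(P.T : ℤ)) P.T, P.phi j

/-- The failure probability of one attempt: `p₀ = 1 - A/(2T)`. [folklore] -/
noncomputable def pNone : ℝ := 1 - P.A / (2 * P.T)

/-- The law of the sampler: `ℓ'(j) = #{sampler = j} / #coins`. [folklore] -/
noncomputable def law (j : ℤ) : ℝ :=
  (cntFirst P.attempt P.J j : ℝ) / (Fintype.card P.AttemptCoins : ℝ) ^ P.J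

/-- `A ≥ φ(0) = 1 > 0`. [folklore] -/
theorem one_le_A : 1 ≤ P.A := by
  unfold A
  have h0 : (0 : ℤ) ∈ Finset.Ioo (-(P.T : ℤ)) P.T := by
    have := P.T_pos; rw [Finset.mem_Ioo]; omega
  rw [← Finset.add_sum_erase _ _ h0, phi_zero]
  linarith [Finset.sum_nonneg fun j (_ : j ∈ (Finset.Ioo (-(P.T : ℤ)) P.T).erase 0) => P.phi_nonneg j]

/-- **`A` over magnitudes**: `A = 1 + 2 ∑_{a=1}^{T-1} (1 - 2^{-k})^{M(a)}` (fold `j ↦ |j|`).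
[folklore] -/
theorem A_eq_one_add : P.A = 1 + 2 * ∑ a ∈ Finset.Ico 1 P.T, (1 - (2 : ℝ)⁻¹ ^ P.k) ^ P.M a := by
  classical
  have hT := P.T_pos
  have hdecomp : Finset.Ioo (-(P.T : ℤ)) P.T =
      insert (0 : ℤ) (((Finset.Ico 1 P.T).image fun a : ℕ => (a : ℤ)) ∪
        ((Finset.Ico 1 P.T).image fun a : ℕ => -(a : ℤ))) := by
    ext j
    simp only [Finset.mem_Ioo, Finset.mem_insert, Finset.mem_union, Finset.mem_image,
      Finset.mem_Ico]
    constructor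
    · intro hj
      rcases lt_trichotomy j 0 with h | h | h
      · right; right; exact ⟨(-j).toNat, by omega, by omega⟩
      · left; exact h
      · right; left; exact ⟨j.toNat, by omega, by omega⟩
    · rintro (h | ⟨a, ha, rfl⟩ | ⟨a, ha, rfl⟩) <;> omega
  have hdisj : Disjoint ((Finset.Ico 1 P.T).image fun a : ℕ => (a : ℤ))
      ((Finset.Ico 1 P.T).image fun a : ℕ => -(a : ℤ)) := by
    rw [Finset.disjoint_left]
    intro j h1 h2
    simp only [Finset.mem_image, Finset.mem_Ico] at h1 h2
    obtain ⟨a, ha, rfl⟩ := h1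
    obtain ⟨b, hb, hab⟩ := h2
    omega
  have h0 : (0 : ℤ) ∉ ((Finset.Ico 1 P.T).image fun a : ℕ => (a : ℤ)) ∪
      ((Finset.Ico 1 P.T).image fun a : ℕ => -(a : ℤ)) := by
    simp only [Finset.mem_union, Finset.mem_image, Finset.mem_Ico, not_or, not_exists, not_and]
    constructor <;> intro a ha <;> omega
  unfold A
  rw [hdecomp, Finset.sum_insert h0, Finset.sum_union hdisj,
    Finset.sum_image fun a _ b _ h => by exact_mod_cast h,
    Finset.sum_image fun a _ b _ h => by simpa using h, phi_zero]
  simp_rw [phi_neg]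
  have hphi : ∀ a ∈ Finset.Ico 1 P.T, P.phi (a : ℤ) = (1 - (2 : ℝ)⁻¹ ^ P.k) ^ P.M a := by
    intro a ha
    rw [Finset.mem_Ico] at ha
    rw [phi, Int.natAbs_natCast, if_pos ha.2]
  rw [Finset.sum_congr rfl hphi]
  ring

/-- `A ≤ 2T - 1 < 2T` (there are `2T - 1` terms, each `≤ 1`). [folklore] -/
theorem A_lt : P.A < 2 * P.T := by
  unfold A
  calc ∑ j ∈ Finset.Ioo (-(P.T : ℤ)) P.T, P.phi j ≤ ∑ _j ∈ Finset.Ioo (-(P.T : ℤ)) P.T, (1 : ℝ) :=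
        Finset.sum_le_sum fun j _ => P.phi_le_one j
    _ = ((Finset.Ioo (-(P.T : ℤ)) P.T).card : ℝ) := by rw [Finset.sum_const, nsmul_eq_mul, mul_one]
    _ < 2 * P.T := by
        rw [Int.card_Ioo]
        have := P.T_pos
        have : ((P.T : ℤ) - -(P.T : ℤ) - 1).toNat = 2 * P.T - 1 := by omega
        rw [this]
        have h1 : 1 ≤ 2 * P.T := by omega
        exact_mod_cast Nat.sub_lt (by omega) one_pos

/-- `0 ≤ p₀ < 1`. [folklore] -/
theorem pNone_nonneg : 0 ≤ P.pNone := by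
  unfold pNone
  have hT : (0 : ℝ) < 2 * P.T := by have := P.T_pos; positivity
  rw [sub_nonneg, div_le_one hT]
  exact (P.A_lt).le

/-- `p₀ < 1`. [folklore] -/
theorem pNone_lt_one : P.pNone < 1 := by
  unfold pNone
  have hT : (0 : ℝ) < 2 * P.T := by have := P.T_pos; positivity
  have : 0 < P.A / (2 * P.T) := div_pos (lt_of_lt_of_le one_pos P.one_le_A) hT
  linarith

/-- **Probability of one accepted value**: `#{attempt = some j} / #coins = φ(j)/(2T)`. [folklore] -/
theorem cntSome_div (j : ℤ) :
    (cntSome P.attempt j : ℝ) / Fintype.card P.AttemptCoins = P.phi j / (2 * P.T) := by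
  rw [cntSome_attempt, card_attemptCoins, phi]
  have hT : (0 : ℝ) < 2 * P.T := by have := P.T_pos; positivity
  have h2k : (0 : ℝ) < (2 : ℝ) ^ P.k := by positivity
  split_ifs with hj
  · have hM := (P.M_lt_Mmax hj).le
    have h21 : 1 ≤ 2 ^ P.k := Nat.one_le_two_pow
    push_cast [Nat.cast_sub h21]
    rw [div_eq_div_iff (by positivity) hT.ne']
    have hsplit : ((2 : ℝ) ^ P.k) ^ P.Mmax = ((2 : ℝ) ^ P.k) ^ P.M j.natAbs * ((2 : ℝ) ^ P.k) ^
        (P.Mmax - P.M j.natAbs) := by rw [← pow_add, Nat.add_sub_cancel' hM]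
    rw [hsplit]
    have hq : (1 - (2 : ℝ)⁻¹ ^ P.k) = ((2 : ℝ) ^ P.k - 1) / (2 : ℝ) ^ P.k := by
      rw [inv_pow, eq_div_iff h2k.ne', sub_mul, inv_mul_cancel₀ h2k.ne', one_mul]
    rw [hq, div_pow]
    field_simp
  · simp

/-- **Failure probability of one attempt**: `#{attempt = none} / #coins = 1 - A/(2T) = p₀`.
[folklore] -/
theorem cntNone_div : (cntNone P.attempt : ℝ) / Fintype.card P.AttemptCoins = P.pNone := by
  have hK : (0 : ℝ) < Fintype.card P.AttemptCoins := by
    rw [card_attemptCoins]; have := P.T_pos; positivity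
  have h := P.cntNone_add_sum_cntSome
  have h' : (cntNone P.attempt : ℝ) = Fintype.card P.AttemptCoins -
      ∑ j ∈ Finset.Ioo (-(P.T : ℤ)) P.T, (cntSome P.attempt j : ℝ) := by
    rw [eq_sub_iff_add_eq]; exact_mod_cast h
  rw [h', sub_div, div_self hK.ne', Finset.sum_div, pNone, A, Finset.sum_div]
  congr 1
  exact Finset.sum_congr rfl fun j _ => P.cntSome_div j

/-- **The law of the sampler, closed form**:
`ℓ'(j) = (φ(j)/A)(1 - p₀^J) + [j = 0] p₀^J`. [folklore] -/
theorem law_eq (j : ℤ) :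
    P.law j = P.phi j / P.A * (1 - P.pNone ^ P.J) + (if j = 0 then P.pNone ^ P.J else 0) := by
  have hK : (0 : ℝ) < Fintype.card P.AttemptCoins := by
    rw [card_attemptCoins]; have := P.T_pos; positivity
  have hT : (0 : ℝ) < 2 * P.T := by have := P.T_pos; positivity
  have hA : 0 < P.A := lt_of_lt_of_le one_pos P.one_le_A
  set K : ℝ := (Fintype.card P.AttemptCoins : ℝ) with hKdef
  have hmul := cntFirst_mul_eq P.attempt P.J j
  have hmulR : (cntFirst P.attempt P.J j : ℝ) * (K - cntNone P.attempt) =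
      cntSome P.attempt j * (K ^ P.J - (cntNone P.attempt : ℝ) ^ P.J) +
        (if j = 0 then (cntNone P.attempt : ℝ) ^ P.J * (K - cntNone P.attempt) else 0) := by
    have := congrArg (fun z : ℤ => (z : ℝ)) hmul
    simp only [Int.cast_mul, Int.cast_add, Int.cast_sub, Int.cast_pow, Int.cast_natCast,
      apply_ite (fun z : ℤ => (z : ℝ)), Int.cast_zero] at this
    rw [← hKdef] at this
    exact this
  -- rewrite the counts as `K` times probabilities
  have hnone : (cntNone P.attempt : ℝ) = K * P.pNone := by
    rw [← P.cntNone_div, hKdef, mul_div_cancel₀ _ hK.ne']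
  have hsome : (cntSome P.attempt j : ℝ) = K * (P.phi j / (2 * P.T)) := by
    rw [← P.cntSome_div, hKdef, mul_div_cancel₀ _ hK.ne']
  have hKp : K - K * P.pNone = K * (P.A / (2 * P.T)) := by rw [pNone]; ring
  rw [hnone, hsome, hKp] at hmulR
  unfold law
  rw [← hKdef]
  have hKJ : (0 : ℝ) < K ^ P.J := pow_pos hK _
  -- divide `hmulR` by `K^{J+1} A/(2T)`
  have key : (cntFirst P.attempt P.J j : ℝ) =
      (P.phi j / P.A * (1 - P.pNone ^ P.J) + (if j = 0 then P.pNone ^ P.J else 0)) * K ^ P.J := by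
    have hne : K * (P.A / (2 * P.T)) ≠ 0 := by positivity
    apply mul_right_cancel₀ hne
    rw [hmulR, mul_pow]
    split_ifs
    · field_simp
    · field_simp
      ring
  rw [key, mul_div_assoc, div_self hKJ.ne', mul_one]

/-- **The law is even** (the attempt's law depends on `|j|` only, and the default `0` is fixed by
negation). [folklore] -/
theorem law_neg (j : ℤ) : P.law (-j) = P.law j := by
  rw [law_eq, law_eq, phi_neg]
  simp only [neg_eq_zero]

/-- **The law is supported in `(-T, T)`.** [folklore] -/
theorem law_eq_zero {j : ℤ} (hj : P.T ≤ j.natAbs) : P.law j = 0 := by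
  rw [law_eq, P.phi_eq_zero hj]
  have : j ≠ 0 := by
    intro h; subst h; have := P.T_pos; simp at hj; omega
  simp [this]

/-- The law is nonnegative. [folklore] -/
theorem law_nonneg (j : ℤ) : 0 ≤ P.law j := by
  unfold law; positivity

/-- **Lower bound by the accepted part**: `ℓ'(j) ≥ (1 - p₀^J) φ(j)/A`. [folklore] -/
theorem phi_div_mul_le_law (j : ℤ) : P.phi j / P.A * (1 - P.pNone ^ P.J) ≤ P.law j := by
  rw [law_eq]
  have : 0 ≤ (if j = 0 then P.pNone ^ P.J else 0) := by
    split_ifs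
    · exact pow_nonneg P.pNone_nonneg _
    · exact le_rfl
  linarith

end PGParams

end Literature.Probability.Distributions
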